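import Summits.BirchSwinnertonDyer.Rank1Residual.Additive.X3BranchAnalyticHalfGordDescent
import Summits.BirchSwinnertonDyer.Rank1Residual.Additive.X3BranchLowerEndStateThm16
import Summits.BirchSwinnertonDyer.Rank1Residual.Additive.PalTwistPeriodHolds
import HarnessLib

/-!
# X3♯(G-ord) ∩ `I₀*`, rank `0`: the END STATE from PRINT + the `W`-LEVEL count `hAlgW` — the `T = 0`
# inputs `ChiBranchLowerLeadingTerm[Odd]At`, `CycLowerLeadingTermAt`, `Typed.MissingLowerBoundAt` and
# `BSD(E,p)` at every `p ≥ 5` (non-CM, non-anomalous) and at `p = 3` (off the degenerate rows), BOTH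
# parities (cell `bsd-addord`, seat `bsd-addord-twist`; sequel of `X3BranchAnalyticHalfGordDescent.lean`)

HONEST FRAMING (cell `bsd-addord`, `run/shared/lean/pub/bsd-addord/README.md` §4): the programme's
target of record is the full Birch–Swinnerton-Dyer formula for every `E/ℚ` of analytic rank `≤ 1`;
this file concerns the X3 rows of cell (G-ord, `e = 2`) of N10/N11 only and books NOTHING: X3 stays
CONSTRUCTION-SHAPED. THEOREMS ONLY (no `def`, no named fact, no `sorry`). PUBLISHED inputs are
explicit named-fact binders passed verbatim to team n1011's / additive-p2's consumers (`hW16`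
Wuthrich 2014 Thm. 16; `hGV` Greenberg–Vatsal 2000 Thm. (3.12) on the branch, reading-fact p396718;
`hPal` Pal 2012 Thm. 3.2 (at `p = 3` discharged by the tree's `pal2012_…_holds`); `hDel` /
`hDel3` Delbourgo 2002; `hDel98` Delbourgo 1998 Prop. 4; `hGZK`; `hmod` / `hmodD`). The ONE unprinted
input is the displayed hypothesis `hAlgW` of the sibling: Greenberg–Vatsal's display (16) with (11)
for the ADDITIVE curve's own Selmer group over `ℚ_∞` — `p^{λ(g) + Σ_{ℓ∈Σ₀} δ_ℓ(W)} =
#H¹(ℚ_Σ/ℚ_∞, Φ₀)·#U(W[p]/Φ₀)` for every `Λ`-dual datum of `Sel_{p^∞}(W/ℚ_∞)` and generator `g` of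
its characteristic ideal with `μ(g) = 0` — NOT in print at an additive prime, never asserted here; it
is the exact output shape of the tree's X2 devissage kernel
(`X2/ResidualDevissageGoodOrdinary.natCard_line_mul_quotSelmer_eq_of_goodOrd`) to be re-run with the
ramified-line Greenberg datum at the additive prime.

## Contents (all from the sibling's `W`-level branch main conjecture `X3Branch.charIdeal_eq_span_of_thm312_of_algebraicCountW`)

* §1 `ClassX3Gord.chiBranchLowerLeadingTermAt_of_thm312_of_algebraicCountW` (`p ≡ 1 (mod 4)`, via
  the Λ-adic containment and `0 ≤ ord_p j` on type (G)) and
  `ClassX3Gord.chiBranchLowerLeadingTermOddAt_of_thm312_of_algebraicCountW` (`p ≡ 3 (mod 4)`, reading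
  the constant term with additive-p2's `exists_padicInt_constantCoeff_eq_of_iwasawaToPowerSeries_eq_mul_minusBranch`;
  a multiplicative twist model is excluded on an additive (G)-ordinary defect-2 pair by
  `TypeGOrd.goodOrd_of_pStar_twist_model`) — additive-p2's typed `T = 0` LOWER inputs on `W`;
  `ClassX3Gord.cycLowerLeadingTermAt_of_thm312_of_algebraicCountW` — `CycLowerLeadingTermAt W p` at
  every odd `p` (Birch + Pal transport).
* §2 `p ≥ 5`, `r_an = 0`, non-CM, non-anomalous:
  `ClassX3Gord.missingLowerBoundAt_rankZero_of_thm312_of_algebraicCountW_of_nonAnomalous`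
  (`Typed.MissingLowerBoundAt W p`) and `ClassX3Gord.bsdp_rankZero_of_thm312_of_algebraicCountW_of_nonAnomalous`
  (`BSDp W p`; upper half = the Wuthrich component chain over `hW16`).
* §3 `p = 3` off the degenerate rows (defect `2` automatic): `…_three_…` forms.

KERNEL SENTENCE (for the cell's TARGET ledger; no mark moved): on X3♯(G-ord) ∩ `I₀*` ∧ `r_an = 0` ∧
branch parity (the even line of `E[p]` is the one whose `χ_{p*}`-twist is ramified, `χφ ≠ 1`), off
CM / anomalous rows, `BSD(E,p)` ⟸ PUBLISHED facts ∧ ONE OPEN statement about `Sel_{p^∞}(E/ℚ_∞)`: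
`λ + Σ_{Σ₀} δ = dim H¹(ℚ_Σ/ℚ_∞, Φ_E) + dim U(E[p]/Φ_E)` at `μ = 0` (GV §2 (16)+(11) for the additive
`E`). Reach (seat census v2, kit j238903, `N < 5·10⁵`, branch-parity non-degenerate (G-ord, `e = 2`)
X3 classes): 1 434 @3 + 202 @5 + 59 @7 + 5 @13 = 1 700 classes, 64 of them with `p ∣ #Ш_an` for some
member (where the lower half is non-trivial).

## What this is NOT

Not a class theorem; not the (M) cell; not the degenerate `p = 3` rows; not rank `1`; no booking.

References: [GreenbergVatsal2000] §2 (11), (16), §3 Thm. (3.12); [Wuthrich2014] Thm. 16, Cor. 18;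
[Delbourgo2002] Theorems (A), (B); [Delbourgo1998] Prop. 4; [Pal2012] Thm. 3.2;
[MazurTateTeitelbaum1986Invent] §I.13–I.14; [Miller2011LMS] Def. 1.1.
-/

set_option autoImplicit false

noncomputable section

open scoped Classical MatrixGroups ModularForm

namespace Summit.BirchSwinnertonDyer.Rank1Residual.Additive

open CongruenceSubgroup WeierstrassCurve NumberField IsDedekindDomain Field
  Literature.NumberTheory.EllipticCurves
  Literature.NumberTheory.EllipticCurves.ModularForms
  Literature.NumberTheory.EllipticCurves.GreenbergVatsal2000
  Literature.NumberTheory.EllipticCurves.Rank1Residual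
  Literature.NumberTheory.EllipticCurves.Rank1Residual.Typed
  Literature.NumberTheory.GaloisRepresentations
  Summit.BirchSwinnertonDyer.Rank1Residual.X1.MuLambda
  Summit.BirchSwinnertonDyer.Rank1Residual.AdditivePotMult
  Summit.BirchSwinnertonDyer.Rank1Residual.Additive.X3Branch

/-! ### §1–§2 The `T = 0` inputs, `CycLowerLeadingTermAt`, and the end state at `p ≥ 5` -/

section WLevel

variable {W : WeierstrassCurve ℚ} [W.IsElliptic] [W.IsGloballyMinimal] {p : ℕ} [hp : Fact p.Prime]

/-- **`p ≡ 1 (mod 4)`, type (G)-ordinary: additive-p2's `T = 0` LOWER input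
`ChiBranchLowerLeadingTermAt W p`** ("every `g ∈ char_Λ X(W/ℚ_∞)` has `g(0) = h·ϖ·∑(a/p)[a/p]⁺_f`")
from `hW16 ∧ hGV ∧ hAlgW` — the sibling's Λ-adic containment read at `T = 0`
(`chiBranchLowerLeadingTermAt_of_divisibility_of_padicValRat_j_nonneg`, `0 ≤ ord_p j` on type (G)).
[cite: MazurTateTeitelbaum1986Invent, §I.14] [cite: GreenbergVatsal2000, §3 Thm. (3.12) p. 45]
[cite: Wuthrich2014, Thm. 16 (p. 397)] -/
theorem ClassX3Gord.chiBranchLowerLeadingTermAt_of_thm312_of_algebraicCountW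
    (hW16 : Wuthrich2014.thm16_halfEigenCharIdeal_dvd_cyclotomicPrime)
    (hGV : thm312_branch_unitContent_and_lambda_eq_residual_goodOrd) (hG : TypeGOrd W p)
    (S₀ : Finset (HeightOneSpectrum (𝓞 ℚ))) (hS₀ : ∀ v ∈ S₀, ((p : ℕ) : 𝓞 ℚ) ∉ v.asIdeal)
    (hS : ∀ v : HeightOneSpectrum (𝓞 ℚ), v ∉ S₀ → ((p : ℕ) : 𝓞 ℚ) ∉ v.asIdeal →
      W.HasGoodReductionAt v)
    (Φ₀ : AddSubgroup (W.geomTorsion (p : ℤ))) (hΦ : IsRationalLine W p Φ₀)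
    (heven : LineEven W p Φ₀)
    (hnt : ∃ (σ : absoluteGaloisGroup ℚ) (P : W.geomTorsion (p : ℤ)), P ∈ Φ₀ ∧ σ • P ≠ P)
    (hram : ∀ (K : Type) [Field K] [NumberField K] [(galRange (K := ℚ) K).Normal],
      Module.finrank ℚ K = 2 → (∃ θ : K, θ ^ 2 = algebraMap ℚ K ((-1) ^ (p / 2) * p)) →
      ¬ ∀ v : HeightOneSpectrum (𝓞 ℚ), ((p : ℕ) : 𝓞 ℚ) ∈ v.asIdeal →
        ∀ 𝔓 ∈ v.primesAbove, ∀ σ ∈ 𝔓.inertia (absoluteGaloisGroup ℚ), ∀ P ∈ Φ₀,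
          σ • P = (if σ ∈ galRange (K := ℚ) K then P else -P))
    (hAlgW : ∀ {κ : ZpExtension ℚ p} {γ : Field.absoluteGaloisGroup ℚ} (D : W.SelmerDualData κ γ)
      (g : IwasawaAlgebra p), κ.IsCyclotomic → κ.IsTopGenerator γ →
      D.charIdeal = Ideal.span {g} → HasUnitContent g →
        p ^ (lam g + ∑ v ∈ S₀, delta W p v) =
          Nat.card (residualLineH1 W p κ S₀ Φ₀ hΦ) * Nat.card (residualQuotSelmer W p κ S₀ Φ₀ hΦ)) :
    ChiBranchLowerLeadingTermAt W p :=
  chiBranchLowerLeadingTermAt_of_divisibility_of_padicValRat_j_nonneg p W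
    (padicValRat_j_nonneg_of_typeGOrd W p hG)
    (X3Branch.chiBranchLowerDivisibilityAt_of_thm312_of_algebraicCountW hW16 hGV S₀ hS₀ hS Φ₀ hΦ heven
      hnt hram hAlgW)

/-- **`p ≡ 3 (mod 4)` (`p = 3` included), additive (G)-ordinary of defect `2`: additive-p2's ODD
`T = 0` LOWER input `ChiBranchLowerLeadingTermOddAt W p`** ("every `g ∈ char_Λ X(W/ℚ_∞)` has
`g(0) = h·ϖ⁻·∑(a/p)[a/p]⁻_f`") from `hW16 ∧ hGV ∧ hAlgW`: every twist model is good ordinary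
(`TypeGOrd.goodOrd_of_pStar_twist_model`, so the multiplicative alternative of the def is void), the
sibling's `W`-level branch main conjecture gives `char = (g')`, `ι g' = u·ϖ·L_p(f, α, ω^m, T)` on the
MINUS branch, and additive-p2's `exists_padicInt_constantCoeff_eq_of_iwasawaToPowerSeries_eq_mul_minusBranch`
reads the constant term. [cite: MazurTateTeitelbaum1986Invent, §I.13–I.14]
[cite: GreenbergVatsal2000, §3 Thm. (3.12) p. 45] [cite: Wuthrich2014, Thm. 16 (p. 397)] -/
theorem ClassX3Gord.chiBranchLowerLeadingTermOddAt_of_thm312_of_algebraicCountW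
    (hW16 : Wuthrich2014.thm16_halfEigenCharIdeal_dvd_cyclotomicPrime)
    (hGV : thm312_branch_unitContent_and_lambda_eq_residual_goodOrd)
    (hG : TypeGOrd W p) (hadd : Addv W p) (he : semistabilityIndex W p = 2)
    (S₀ : Finset (HeightOneSpectrum (𝓞 ℚ))) (hS₀ : ∀ v ∈ S₀, ((p : ℕ) : 𝓞 ℚ) ∉ v.asIdeal)
    (hS : ∀ v : HeightOneSpectrum (𝓞 ℚ), v ∉ S₀ → ((p : ℕ) : 𝓞 ℚ) ∉ v.asIdeal →
      W.HasGoodReductionAt v)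
    (Φ₀ : AddSubgroup (W.geomTorsion (p : ℤ))) (hΦ : IsRationalLine W p Φ₀)
    (heven : LineEven W p Φ₀)
    (hnt : ∃ (σ : absoluteGaloisGroup ℚ) (P : W.geomTorsion (p : ℤ)), P ∈ Φ₀ ∧ σ • P ≠ P)
    (hram : ∀ (K : Type) [Field K] [NumberField K] [(galRange (K := ℚ) K).Normal],
      Module.finrank ℚ K = 2 → (∃ θ : K, θ ^ 2 = algebraMap ℚ K ((-1) ^ (p / 2) * p)) →
      ¬ ∀ v : HeightOneSpectrum (𝓞 ℚ), ((p : ℕ) : 𝓞 ℚ) ∈ v.asIdeal →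
        ∀ 𝔓 ∈ v.primesAbove, ∀ σ ∈ 𝔓.inertia (absoluteGaloisGroup ℚ), ∀ P ∈ Φ₀,
          σ • P = (if σ ∈ galRange (K := ℚ) K then P else -P))
    (hAlgW : ∀ {κ : ZpExtension ℚ p} {γ : Field.absoluteGaloisGroup ℚ} (D : W.SelmerDualData κ γ)
      (g : IwasawaAlgebra p), κ.IsCyclotomic → κ.IsTopGenerator γ →
      D.charIdeal = Ideal.span {g} → HasUnitContent g →
        p ^ (lam g + ∑ v ∈ S₀, delta W p v) =
          Nat.card (residualLineH1 W p κ S₀ Φ₀ hΦ) * Nat.card (residualQuotSelmer W p κ S₀ Φ₀ hΦ)) :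
    ChiBranchLowerLeadingTermOddAt W p := by
  intro V _ _ κ γ N _ f hp3 hCW hred hκ hγ hcv hf D ϖ hϖ g hg
  have hp2 : p ≠ 2 := by omega
  have hodd : ¬ Even (p / 2) := by rw [Nat.not_even_iff_odd]; exact ⟨p / 4, by omega⟩
  obtain ⟨C, hC⟩ := hCW
  have hC' : C • V.quadraticTwist ((-1) ^ (p / 2) * p : ℚ) = W := by
    rw [pStar_eq_neg_of_mod_four_eq_three hp3]; exact hC
  have hgood : GoodOrd V p := TypeGOrd.goodOrd_of_pStar_twist_model hp2 hG hadd he ⟨C, hC'⟩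
  have hord : IsOrdinaryAt V p := (isOrdinaryAt_iff V p).mpr ⟨hgood.1, hgood.2⟩
  obtain ⟨-, g', hchar, u, hι⟩ := X3Branch.charIdeal_eq_span_of_thm312_of_algebraicCountW hW16 hGV
    hp2 hgood hC' S₀ hS₀ hS Φ₀ hΦ heven hnt hram hAlgW hκ hγ hcv hf D ϖ (by rw [if_neg hodd]; exact hϖ)
  rw [if_neg hodd] at hι
  have hg' : g ∈ Ideal.span ({g'} : Set (IwasawaAlgebra p)) := by rw [← hchar]; exact hg
  obtain ⟨a, rfl⟩ := Ideal.mem_span_singleton'.mp hg'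
  have hCu : PowerSeries.C ((((u : ℤ_[p]) : ℚ_[p])) * (ϖ : ℚ_[p])) =
      PowerSeries.C (((u : ℤ_[p]) : ℚ_[p])) * PowerSeries.C (ϖ : ℚ_[p]) := map_mul _ _ _
  have hιg : iwasawaToPowerSeries p (a * g') =
      iwasawaToPowerSeries p (PowerSeries.C (u : ℤ_[p]) * a) *
        (PowerSeries.C ((ϖ : ℚ) : ℚ_[p]) *
          padicLFunctionMinusBranch f (unitRoot V p : ℚ_[p]) (p / 2)) := by
    rw [map_mul, hι, iwasawaToPowerSeries_C_mul', hCu]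
    ring
  exact exists_padicInt_constantCoeff_eq_of_iwasawaToPowerSeries_eq_mul_minusBranch p hp2 V hord hf hιg

/-- **X3♯(G-ord) ∩ `I₀*`, every odd `p`: the cyclotomic `T = 0` LOWER input
`CycLowerLeadingTermAt W p`** ("for every generator `f` of `char_Λ X(E/ℚ_∞)`, `L(E,1)/Ω_E ∣ f(0)`")
from `hW16 ∧ hGV ∧ hAlgW` and the PUBLISHED Birch + Pal transport
(`cycLowerLeadingTermAt_iff_chiBranchLower[Odd]_of_typeGOrd_of_semistabilityIndex_eq_two`; `hPal`
only on the even branch). Rank-free. [cite: Pal2012, Thm. 3.2] [cite: MazurTateTeitelbaum1986Invent, §I.13–I.14]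
[cite: GreenbergVatsal2000, §3 Thm. (3.12) p. 45] [cite: Wuthrich2014, Thm. 16 (p. 397)] -/
theorem ClassX3Gord.cycLowerLeadingTermAt_of_thm312_of_algebraicCountW
    (hW16 : Wuthrich2014.thm16_halfEigenCharIdeal_dvd_cyclotomicPrime)
    (hGV : thm312_branch_unitContent_and_lambda_eq_residual_goodOrd)
    (hPal : Pal2012.thm32_sqrt_mul_realPeriodRat_twist_eq_of_prime_one_mod_four)
    (hmod : hasEntireLFunction_rat) (hmodD : nonempty_modularParametrizationData)
    (hX : ClassX3Gord W p) (hp2 : p ≠ 2) (he : semistabilityIndex W p = 2)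
    (S₀ : Finset (HeightOneSpectrum (𝓞 ℚ))) (hS₀ : ∀ v ∈ S₀, ((p : ℕ) : 𝓞 ℚ) ∉ v.asIdeal)
    (hS : ∀ v : HeightOneSpectrum (𝓞 ℚ), v ∉ S₀ → ((p : ℕ) : 𝓞 ℚ) ∉ v.asIdeal →
      W.HasGoodReductionAt v)
    (Φ₀ : AddSubgroup (W.geomTorsion (p : ℤ))) (hΦ : IsRationalLine W p Φ₀)
    (heven : LineEven W p Φ₀)
    (hnt : ∃ (σ : absoluteGaloisGroup ℚ) (P : W.geomTorsion (p : ℤ)), P ∈ Φ₀ ∧ σ • P ≠ P)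
    (hram : ∀ (K : Type) [Field K] [NumberField K] [(galRange (K := ℚ) K).Normal],
      Module.finrank ℚ K = 2 → (∃ θ : K, θ ^ 2 = algebraMap ℚ K ((-1) ^ (p / 2) * p)) →
      ¬ ∀ v : HeightOneSpectrum (𝓞 ℚ), ((p : ℕ) : 𝓞 ℚ) ∈ v.asIdeal →
        ∀ 𝔓 ∈ v.primesAbove, ∀ σ ∈ 𝔓.inertia (absoluteGaloisGroup ℚ), ∀ P ∈ Φ₀,
          σ • P = (if σ ∈ galRange (K := ℚ) K then P else -P))
    (hAlgW : ∀ {κ : ZpExtension ℚ p} {γ : Field.absoluteGaloisGroup ℚ} (D : W.SelmerDualData κ γ)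
      (g : IwasawaAlgebra p), κ.IsCyclotomic → κ.IsTopGenerator γ →
      D.charIdeal = Ideal.span {g} → HasUnitContent g →
        p ^ (lam g + ∑ v ∈ S₀, delta W p v) =
          Nat.card (residualLineH1 W p κ S₀ Φ₀ hΦ) * Nat.card (residualQuotSelmer W p κ S₀ Φ₀ hΦ)) :
    CycLowerLeadingTermAt W p := by
  have hodd := hp.out.eq_two_or_odd'
  by_cases hp4 : p % 4 = 1
  · exact (cycLowerLeadingTermAt_iff_chiBranchLower_of_typeGOrd_of_semistabilityIndex_eq_two W p hPal
      hmod hmodD hp4 hX.addv hX.typeGOrd he).mpr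
      (ClassX3Gord.chiBranchLowerLeadingTermAt_of_thm312_of_algebraicCountW hW16 hGV hX.typeGOrd S₀ hS₀
        hS Φ₀ hΦ heven hnt hram hAlgW)
  · have hp4' : p % 4 = 3 := by
      rcases hodd with h | h
      · exact absurd h hp2
      · obtain ⟨k, hk⟩ := h; omega
    exact (cycLowerLeadingTermAt_iff_chiBranchLowerOdd_of_typeGOrd_of_semistabilityIndex_eq_two W p
      hmod hmodD hp4' hX.addv hX.typeGOrd he).mpr
      (ClassX3Gord.chiBranchLowerLeadingTermOddAt_of_thm312_of_algebraicCountW hW16 hGV hX.typeGOrd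
        hX.addv he S₀ hS₀ hS Φ₀ hΦ heven hnt hram hAlgW)

/-- **X3♯(G-ord) ∩ `I₀*`, `p ≥ 5`, `r_an = 0`, `E` non-CM, OFF the anomalous rows: the N10 decl of
record `Typed.MissingLowerBoundAt W p` from PRINT + the `W`-level count.** PUBLISHED: `hW16`, `hGV`,
`hPal`, `hDel` (Delbourgo 2002 (A)+(B)), `hGZK`, `hmod`, `hmodD`. OPEN, displayed: `hAlgW` (GV (16)+(11)
for `Sel_{p^∞}(W/ℚ_∞)`). Into additive-p2's `ClassX3Gord.missingLowerBoundAt_rankZero_of_cycLower_of_nonAnomalous`.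
T-X3-χ with its analytic half AND its twist descent discharged in the kernel. NOT a class theorem;
nothing booked. [cite: Delbourgo2002, Theorem (A), (B) (p. 40)] [cite: Pal2012, Thm. 3.2]
[cite: GreenbergVatsal2000, §2 (16), §3 Thm. (3.12) p. 45] [cite: Wuthrich2014, Thm. 16 (p. 397)]
[cite: Miller2011LMS, Def. 1.1] -/
theorem ClassX3Gord.missingLowerBoundAt_rankZero_of_thm312_of_algebraicCountW_of_nonAnomalous
    (hW16 : Wuthrich2014.thm16_halfEigenCharIdeal_dvd_cyclotomicPrime)
    (hGV : thm312_branch_unitContent_and_lambda_eq_residual_goodOrd)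
    (hPal : Pal2012.thm32_sqrt_mul_realPeriodRat_twist_eq_of_prime_one_mod_four)
    (hDel : Delbourgo2002.mainTheorem)
    (hGZK : rank_eq_analyticRank_of_analyticRank_le_one) (hmod : hasEntireLFunction_rat)
    (hmodD : nonempty_modularParametrizationData)
    (hX : ClassX3Gord W p) (hcm : ¬ W.HasCM) (hp5 : 5 ≤ p) (he : semistabilityIndex W p = 2)
    (hr : W.analyticRank = 0) (hna : Delbourgo2002.ReductionNonAnomalous W p)
    (S₀ : Finset (HeightOneSpectrum (𝓞 ℚ))) (hS₀ : ∀ v ∈ S₀, ((p : ℕ) : 𝓞 ℚ) ∉ v.asIdeal)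
    (hS : ∀ v : HeightOneSpectrum (𝓞 ℚ), v ∉ S₀ → ((p : ℕ) : 𝓞 ℚ) ∉ v.asIdeal →
      W.HasGoodReductionAt v)
    (Φ₀ : AddSubgroup (W.geomTorsion (p : ℤ))) (hΦ : IsRationalLine W p Φ₀)
    (heven : LineEven W p Φ₀)
    (hnt : ∃ (σ : absoluteGaloisGroup ℚ) (P : W.geomTorsion (p : ℤ)), P ∈ Φ₀ ∧ σ • P ≠ P)
    (hram : ∀ (K : Type) [Field K] [NumberField K] [(galRange (K := ℚ) K).Normal],
      Module.finrank ℚ K = 2 → (∃ θ : K, θ ^ 2 = algebraMap ℚ K ((-1) ^ (p / 2) * p)) →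
      ¬ ∀ v : HeightOneSpectrum (𝓞 ℚ), ((p : ℕ) : 𝓞 ℚ) ∈ v.asIdeal →
        ∀ 𝔓 ∈ v.primesAbove, ∀ σ ∈ 𝔓.inertia (absoluteGaloisGroup ℚ), ∀ P ∈ Φ₀,
          σ • P = (if σ ∈ galRange (K := ℚ) K then P else -P))
    (hAlgW : ∀ {κ : ZpExtension ℚ p} {γ : Field.absoluteGaloisGroup ℚ} (D : W.SelmerDualData κ γ)
      (g : IwasawaAlgebra p), κ.IsCyclotomic → κ.IsTopGenerator γ →
      D.charIdeal = Ideal.span {g} → HasUnitContent g →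
        p ^ (lam g + ∑ v ∈ S₀, delta W p v) =
          Nat.card (residualLineH1 W p κ S₀ Φ₀ hΦ) * Nat.card (residualQuotSelmer W p κ S₀ Φ₀ hΦ)) :
    MissingLowerBoundAt W p :=
  ClassX3Gord.missingLowerBoundAt_rankZero_of_cycLower_of_nonAnomalous hDel hGZK hmod hX hcm hp5 hr
    (ClassX3Gord.cycLowerLeadingTermAt_of_thm312_of_algebraicCountW hW16 hGV hPal hmod hmodD hX
      (by omega) he S₀ hS₀ hS Φ₀ hΦ heven hnt hram hAlgW) hna

/-- **X3♯(G-ord) ∩ `I₀*`, `p ≥ 5`, `r_an = 0`, `E` non-CM, OFF the anomalous rows: Miller's `BSD(E,p)`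
from PRINT + the `W`-level count.** Lower half as in the previous theorem; upper half = the Wuthrich
component chain (additive-p2's `ClassX3Gord.bsdp_rankZero_of_cycLower_of_wuthrichComponent`, over the
component reading derived from `hW16`) with Delbourgo 1998 Prop. 4 (`hDel98`). No image, Tamagawa,
Manin or `#Ш_an` hypothesis. NOT a class theorem; nothing booked.
[cite: Delbourgo2002, Theorem (A), (B) (p. 40)] [cite: Delbourgo1998, Prop. 4 (p. 144)]
[cite: Wuthrich2014, Thm. 16 (p. 397), Cor. 18] [cite: GreenbergVatsal2000, §2 (16), §3 Thm. (3.12) p. 45]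
[cite: Pal2012, Thm. 3.2] [cite: Miller2011LMS, §1 and Def. 1.1] -/
theorem ClassX3Gord.bsdp_rankZero_of_thm312_of_algebraicCountW_of_nonAnomalous
    (hW16 : Wuthrich2014.thm16_halfEigenCharIdeal_dvd_cyclotomicPrime)
    (hGV : thm312_branch_unitContent_and_lambda_eq_residual_goodOrd)
    (hPal : Pal2012.thm32_sqrt_mul_realPeriodRat_twist_eq_of_prime_one_mod_four)
    (hDel98 : Delbourgo1998.prop4_rankZero_pow_dvd_constantCoeff) (hDel : Delbourgo2002.mainTheorem)
    (hGZK : rank_eq_analyticRank_of_analyticRank_le_one) (hmod : hasEntireLFunction_rat)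
    (hmodD : nonempty_modularParametrizationData)
    (hX : ClassX3Gord W p) (hcm : ¬ W.HasCM) (hp5 : 5 ≤ p) (he : semistabilityIndex W p = 2)
    (hr : W.analyticRank = 0) (hna : Delbourgo2002.ReductionNonAnomalous W p)
    (S₀ : Finset (HeightOneSpectrum (𝓞 ℚ))) (hS₀ : ∀ v ∈ S₀, ((p : ℕ) : 𝓞 ℚ) ∉ v.asIdeal)
    (hS : ∀ v : HeightOneSpectrum (𝓞 ℚ), v ∉ S₀ → ((p : ℕ) : 𝓞 ℚ) ∉ v.asIdeal →
      W.HasGoodReductionAt v)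
    (Φ₀ : AddSubgroup (W.geomTorsion (p : ℤ))) (hΦ : IsRationalLine W p Φ₀)
    (heven : LineEven W p Φ₀)
    (hnt : ∃ (σ : absoluteGaloisGroup ℚ) (P : W.geomTorsion (p : ℤ)), P ∈ Φ₀ ∧ σ • P ≠ P)
    (hram : ∀ (K : Type) [Field K] [NumberField K] [(galRange (K := ℚ) K).Normal],
      Module.finrank ℚ K = 2 → (∃ θ : K, θ ^ 2 = algebraMap ℚ K ((-1) ^ (p / 2) * p)) →
      ¬ ∀ v : HeightOneSpectrum (𝓞 ℚ), ((p : ℕ) : 𝓞 ℚ) ∈ v.asIdeal →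
        ∀ 𝔓 ∈ v.primesAbove, ∀ σ ∈ 𝔓.inertia (absoluteGaloisGroup ℚ), ∀ P ∈ Φ₀,
          σ • P = (if σ ∈ galRange (K := ℚ) K then P else -P))
    (hAlgW : ∀ {κ : ZpExtension ℚ p} {γ : Field.absoluteGaloisGroup ℚ} (D : W.SelmerDualData κ γ)
      (g : IwasawaAlgebra p), κ.IsCyclotomic → κ.IsTopGenerator γ →
      D.charIdeal = Ideal.span {g} → HasUnitContent g →
        p ^ (lam g + ∑ v ∈ S₀, delta W p v) =
          Nat.card (residualLineH1 W p κ S₀ Φ₀ hΦ) * Nat.card (residualQuotSelmer W p κ S₀ Φ₀ hΦ)) :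
    BSDp W p :=
  ClassX3Gord.bsdp_rankZero_of_cycLower_of_wuthrichComponent
    (Wuthrich2014.charIdeal_dvd_padicLFunctionBranch_component_of_half hW16) hPal hDel98 hDel hGZK hmod
    hmodD hX hcm hp5 he hr
    (ClassX3Gord.cycLowerLeadingTermAt_of_thm312_of_algebraicCountW hW16 hGV hPal hmod hmodD hX
      (by omega) he S₀ hS₀ hS Φ₀ hΦ heven hnt hram hAlgW) hna

end WLevel

/-! ### §3 `p = 3` (twist by `−3`; the (G)-ordinary defect at `3` is `2` automatically; `χφ ≠ 1` excludes the degenerate rows) -/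

section Three

variable {W : WeierstrassCurve ℚ} [W.IsElliptic] [W.IsGloballyMinimal]

/-- **X3♯(G-ord) at `3`, `r_an = 0`, non-CM, OFF the anomalous and degenerate rows:
`Typed.MissingLowerBoundAt W 3` from PRINT + the displayed `W`-level count `hAlgW`** (defect `2` is
automatic at `3`, `semistabilityIndex_eq_two_of_typeG_three`; Delbourgo 2002 at `3`, `hDel3`; the
`ω`-branch of `E♭ = E ⊗ χ_{−3}`). NOT a class theorem; nothing booked.
[cite: Delbourgo2002, Theorem (A), (B) (p. 40)] [cite: GreenbergVatsal2000, §2 (16), §3 Thm. (3.12) p. 45]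
[cite: Wuthrich2014, Thm. 16 (p. 397)] [cite: Miller2011LMS, Def. 1.1] -/
theorem ClassX3Gord.missingLowerBoundAt_three_rankZero_of_thm312_of_algebraicCountW_of_nonAnomalous
    [hp : Fact (Nat.Prime 3)]
    (hW16 : Wuthrich2014.thm16_halfEigenCharIdeal_dvd_cyclotomicPrime)
    (hGV : thm312_branch_unitContent_and_lambda_eq_residual_goodOrd)
    (hDel3 : Delbourgo2002.mainTheorem_three)
    (hGZK : rank_eq_analyticRank_of_analyticRank_le_one) (hmod : hasEntireLFunction_rat)
    (hmodD : nonempty_modularParametrizationData)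
    (hX : ClassX3Gord W 3) (hcm : ¬ W.HasCM) (hr : W.analyticRank = 0)
    (hna : Delbourgo2002.ReductionNonAnomalous W 3)
    (S₀ : Finset (HeightOneSpectrum (𝓞 ℚ))) (hS₀ : ∀ v ∈ S₀, (((3 : ℕ) : ℕ) : 𝓞 ℚ) ∉ v.asIdeal)
    (hS : ∀ v : HeightOneSpectrum (𝓞 ℚ), v ∉ S₀ → (((3 : ℕ) : ℕ) : 𝓞 ℚ) ∉ v.asIdeal →
      W.HasGoodReductionAt v)
    (Φ₀ : AddSubgroup (W.geomTorsion ((3 : ℕ) : ℤ))) (hΦ : IsRationalLine W 3 Φ₀)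
    (heven : LineEven W 3 Φ₀)
    (hnt : ∃ (σ : absoluteGaloisGroup ℚ) (P : W.geomTorsion ((3 : ℕ) : ℤ)), P ∈ Φ₀ ∧ σ • P ≠ P)
    (hram : ∀ (K : Type) [Field K] [NumberField K] [(galRange (K := ℚ) K).Normal],
      Module.finrank ℚ K = 2 →
      (∃ θ : K, θ ^ 2 = algebraMap ℚ K ((-1) ^ ((3 : ℕ) / 2) * (3 : ℕ))) →
      ¬ ∀ v : HeightOneSpectrum (𝓞 ℚ), (((3 : ℕ) : ℕ) : 𝓞 ℚ) ∈ v.asIdeal →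
        ∀ 𝔓 ∈ v.primesAbove, ∀ σ ∈ 𝔓.inertia (absoluteGaloisGroup ℚ), ∀ P ∈ Φ₀,
          σ • P = (if σ ∈ galRange (K := ℚ) K then P else -P))
    (hAlgW : ∀ {κ : ZpExtension ℚ 3} {γ : Field.absoluteGaloisGroup ℚ} (D : W.SelmerDualData κ γ)
      (g : IwasawaAlgebra 3), κ.IsCyclotomic → κ.IsTopGenerator γ →
      D.charIdeal = Ideal.span {g} → HasUnitContent g →
        3 ^ (lam g + ∑ v ∈ S₀, delta W 3 v) =
          Nat.card (residualLineH1 W 3 κ S₀ Φ₀ hΦ) * Nat.card (residualQuotSelmer W 3 κ S₀ Φ₀ hΦ)) :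
    MissingLowerBoundAt W 3 :=
  ClassX3Gord.missingLowerBoundAt_three_rankZero_of_cycLower_of_nonAnomalous hDel3 hGZK hmod hX hcm hr
    hna
    (ClassX3Gord.cycLowerLeadingTermAt_of_thm312_of_algebraicCountW hW16 hGV
      pal2012_thm32_sqrt_mul_realPeriodRat_twist_eq_of_prime_one_mod_four_holds hmod hmodD hX
      (by norm_num) (semistabilityIndex_eq_two_of_typeG_three W hX.typeGOrd.typeG hX.addv) S₀ hS₀ hS
      Φ₀ hΦ heven hnt hram hAlgW)

/-- **X3♯(G-ord) at `3`, `r_an = 0`, non-CM, OFF the anomalous and degenerate rows: `BSD(E,3)` from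
PRINT + the displayed `W`-level count `hAlgW`** (lower: Delbourgo 2002 at `3`; upper: the minus-eigen
Wuthrich chain at `3`, derived from `hW16`, with Delbourgo 1998 Prop. 4). No image / Tamagawa /
Manin / `#Ш_an` hypothesis. NOT a class theorem; nothing booked.
[cite: Delbourgo2002, Theorem (A), (B) (p. 40)] [cite: Delbourgo1998, Prop. 4 (p. 144)]
[cite: Wuthrich2014, Thm. 16 (p. 397)] [cite: GreenbergVatsal2000, §2 (16), §3 Thm. (3.12) p. 45]
[cite: Miller2011LMS, §1 and Def. 1.1] -/
theorem ClassX3Gord.bsdp_three_rankZero_of_thm312_of_algebraicCountW_of_nonAnomalous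
    [hp : Fact (Nat.Prime 3)]
    (hW16 : Wuthrich2014.thm16_halfEigenCharIdeal_dvd_cyclotomicPrime)
    (hGV : thm312_branch_unitContent_and_lambda_eq_residual_goodOrd)
    (hDel3 : Delbourgo2002.mainTheorem_three)
    (hDel98 : Delbourgo1998.prop4_rankZero_pow_dvd_constantCoeff)
    (hGZK : rank_eq_analyticRank_of_analyticRank_le_one) (hmod : hasEntireLFunction_rat)
    (hmodD : nonempty_modularParametrizationData)
    (hX : ClassX3Gord W 3) (hcm : ¬ W.HasCM) (hr : W.analyticRank = 0)
    (hna : Delbourgo2002.ReductionNonAnomalous W 3)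
    (S₀ : Finset (HeightOneSpectrum (𝓞 ℚ))) (hS₀ : ∀ v ∈ S₀, (((3 : ℕ) : ℕ) : 𝓞 ℚ) ∉ v.asIdeal)
    (hS : ∀ v : HeightOneSpectrum (𝓞 ℚ), v ∉ S₀ → (((3 : ℕ) : ℕ) : 𝓞 ℚ) ∉ v.asIdeal →
      W.HasGoodReductionAt v)
    (Φ₀ : AddSubgroup (W.geomTorsion ((3 : ℕ) : ℤ))) (hΦ : IsRationalLine W 3 Φ₀)
    (heven : LineEven W 3 Φ₀)
    (hnt : ∃ (σ : absoluteGaloisGroup ℚ) (P : W.geomTorsion ((3 : ℕ) : ℤ)), P ∈ Φ₀ ∧ σ • P ≠ P)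
    (hram : ∀ (K : Type) [Field K] [NumberField K] [(galRange (K := ℚ) K).Normal],
      Module.finrank ℚ K = 2 →
      (∃ θ : K, θ ^ 2 = algebraMap ℚ K ((-1) ^ ((3 : ℕ) / 2) * (3 : ℕ))) →
      ¬ ∀ v : HeightOneSpectrum (𝓞 ℚ), (((3 : ℕ) : ℕ) : 𝓞 ℚ) ∈ v.asIdeal →
        ∀ 𝔓 ∈ v.primesAbove, ∀ σ ∈ 𝔓.inertia (absoluteGaloisGroup ℚ), ∀ P ∈ Φ₀,
          σ • P = (if σ ∈ galRange (K := ℚ) K then P else -P))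
    (hAlgW : ∀ {κ : ZpExtension ℚ 3} {γ : Field.absoluteGaloisGroup ℚ} (D : W.SelmerDualData κ γ)
      (g : IwasawaAlgebra 3), κ.IsCyclotomic → κ.IsTopGenerator γ →
      D.charIdeal = Ideal.span {g} → HasUnitContent g →
        3 ^ (lam g + ∑ v ∈ S₀, delta W 3 v) =
          Nat.card (residualLineH1 W 3 κ S₀ Φ₀ hΦ) * Nat.card (residualQuotSelmer W 3 κ S₀ Φ₀ hΦ)) :
    BSDp W 3 :=
  ClassX3Gord.bsdp_three_rankZero_of_cycLower_of_nonAnomalous hDel3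
    (thm16_minusEigenCharIdeal_dvd_cyclotomicThree_of_half hW16) hDel98 hGZK hmod hmodD hX hcm hr hna
    (ClassX3Gord.cycLowerLeadingTermAt_of_thm312_of_algebraicCountW hW16 hGV
      pal2012_thm32_sqrt_mul_realPeriodRat_twist_eq_of_prime_one_mod_four_holds hmod hmodD hX
      (by norm_num) (semistabilityIndex_eq_two_of_typeG_three W hX.typeGOrd.typeG hX.addv) S₀ hS₀ hS
      Φ₀ hΦ heven hnt hram hAlgW)

end Three

end Summit.BirchSwinnertonDyer.Rank1Residual.Additive

end
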